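import Summits.CriticalPhenomena.PercolationContinuityZ3.Theorems.Transplant.PlanarSkeletonConcDefs
import Summits.CriticalPhenomena.PercolationContinuityZ3.Theorems.Transplant.PlanarSkeletonBoxProd
import HarnessLib

/-!
# The node of record on QUASI-TRANSITIVE graphs: the uniqueness input (U) is never a hypothesis — Hutchcroft's theorem on the
# exponential-growth branch, Burton–Keane on the amenable branch (INPUT(G) = structure + `p_c < 1` + Φ2 at `p_c`, P4-GENERAL §13.1/§14.0)

builds on p205010 (kernel theorem, internal audit signed; external expert review pending) — nothing in this file uses p205010 (the near-one
gluing enters the intended PROOF of the node, not these implications).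
Lane `prim-bschramm`, seat `prim-bschramm-p4` (gen 6; PART C3, METHOD = abstract closing argument: INPUT(G) as weak as possible); helper file
(`--supports stmt-CriticalPhenomena-4575 --as helper`).

P4-GENERAL §13.1 listed INPUT_v5(G,t) = (Φ) a `PlanarSkeletonConc`, (Φ2) cylinders at `p_c`, (U) a.s. uniqueness at `p_c`, (L) `p_c < 1`,
and remarked that (U) "never bites" on quasi-transitive graphs.  This file makes that remark a theorem:
* `continuity_of_skeletonConcLt_drop_qt` — node of record + connected, locally finite, QUASI-TRANSITIVE `G` + `PlanarSkeletonConc` +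
  `p_c(G,t) < 1` + `CylSubcritical(p_c)` ⇒ `θ_t(p_c) = 0` (exponential growth: `Hutchcroft2016_noPercolationAtCriticality_holds` settles it
  outright, even without the node; subexponential growth: `hasExponentialGrowth_of_not_isGraphAmenable` (contrapositive) gives amenability
  and `continuity_of_skeletonConcLt_drop_amenable` applies);
* `skeletonConcCriticalContinuity_qt` — the same from the normal form `SkeletonConcCriticalContinuity`.
So for quasi-transitive graphs — the setting of Benjamini–Schramm's Conjecture 4 — the infinite-volume input beyond the node is exactly:
the STRUCTURE `PlanarSkeletonConc`, the B–S hypothesis `p_c < 1`, and cylinder subcriticality at `p_c` (necessary by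
`SkeletonConcInputsNecessary.inputs_of_continuity`).
[cite: BenjaminiSchramm1996, Conj. 4] [cite: Hutchcroft2016, Thm. 1] [cite: LyonsPeres2016, §6.1 p. 279 and Thm. 7.6]
-/

noncomputable section

namespace Summit.CriticalPhenomena.PercolationContinuityZ3.Theorems.Transplant

open MeasureTheory Literature.Probability.Percolation Literature.Probability.LatticeModels
open Literature.Barriers.CriticalPhenomena (IsQuasiTransitive IsGraphAmenable HasExponentialGrowth
  hasExponentialGrowth_of_not_isGraphAmenable Hutchcroft2016_noPercolationAtCriticality_holds)

/-- **The node of record settles every quasi-transitive `PlanarSkeletonConc` graph with `p_c < 1` and subcritical cylinders at `p_c`** — no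
uniqueness hypothesis: on the exponential-growth branch Hutchcroft's theorem gives `θ_t(p_c) = 0` outright, on the subexponential branch the
graph is amenable (Lyons–Peres §6.1) and Burton–Keane supplies uniqueness inside `continuity_of_skeletonConcLt_drop_amenable`.
[cite: BenjaminiSchramm1996, Conj. 4] [cite: Hutchcroft2016, Thm. 1] [cite: LyonsPeres2016, §6.1 p. 279 and Thm. 7.6] -/
theorem continuity_of_skeletonConcLt_drop_qt (hD : SamePDropOfSkeletonConcLt) {V : Type} [DecidableEq V]
    (G : SimpleGraph V) [G.LocallyFinite] (Φ : PlanarSkeletonConc G) (hc : G.Connected) (hq : IsQuasiTransitive G)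
    (t : V) (ht : t ∈ Φ.types) (hpc : criticalProb G t < 1)
    (hC : Φ.toPlanarSkeleton.CylSubcritical (criticalProbIOf G t)) : theta G t (criticalProbIOf G t) = 0 := by
  by_cases hg : HasExponentialGrowth G
  · exact Hutchcroft2016_noPercolationAtCriticality_holds G hc hq hg t
  · exact continuity_of_skeletonConcLt_drop_amenable hD G Φ hc hq
      (by_contra fun hna => hg (hasExponentialGrowth_of_not_isGraphAmenable G hq hna)) t ht hpc hC

/-- **The same from the normal form at criticality** (`SkeletonConcCriticalContinuity ↔ SamePDropOfSkeletonConcLt`, p5-g4's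
`samePDropOfSkeletonConcLt_iff_critical`). [cite: BenjaminiSchramm1996, Conj. 4] -/
theorem skeletonConcCriticalContinuity_qt (hK : SkeletonConcCriticalContinuity) {V : Type} [DecidableEq V]
    (G : SimpleGraph V) [G.LocallyFinite] (Φ : PlanarSkeletonConc G) (hc : G.Connected) (hq : IsQuasiTransitive G)
    (t : V) (ht : t ∈ Φ.types) (hpc : criticalProb G t < 1)
    (hC : Φ.toPlanarSkeleton.CylSubcritical (criticalProbIOf G t)) : theta G t (criticalProbIOf G t) = 0 :=
  continuity_of_skeletonConcLt_drop_qt (samePDropOfSkeletonConcLt_iff_critical.2 hK) G Φ hc hq t ht hpc hC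

end Summit.CriticalPhenomena.PercolationContinuityZ3.Theorems.Transplant

end
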